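import Literature.MathematicalPhysics.QuantumFieldTheory.Balaban1983to89.B1Eq17Urep
import Literature.MathematicalPhysics.QuantumFieldTheory.Balaban1983to89.B2Sect3AGaussianStep

/-!
# `Balaban1983to89.B2Eq220CovDerivSplit` — [Balaban1982Higgs2] (2.20)–(2.21) p. 561: the splitting of the covariant derivative
under `A = B̃⁽¹⁾ + A″` and the resulting «same restrictions with c₁p(ε)» bound — PROVED (theorems only) over the cross-paper
lattice calculus `…LatticeFieldCalculus.covDerivScalar` (r18) and the concrete representation `U(A) = exp(qεeA)`
(`…HiggsLattice.ChargeData.Urep`, typer; bridge p32 `…B1Eq17Urep`)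

statement-level skeleton of published theorems with citation tags; proofs where landed; nothing here is a claim about the Yang–Mills mass gap

CITATION HEADER.  T. Bałaban, *(Higgs)₂,₃ quantum fields in a finite volume. II. An upper bound*, Commun. Math. Phys.
**86** (1982) 555–594 [Balaban1982Higgs2] (cell paper B2; PDF held `paper:balaban1982-cmp86-higgs23-ii`, journal page =
PDF page + 554; p. 561 READ AS IMAGE on the ×2 render
`run/shared/lean/pub/pub-balaban/b2b-balaban-ref1/pages/1982-cmp86-higgs23-II/1982-cmp86-higgs23-II-p007-x2.png`).
Unit `lit-balaban-p15` gen 2 (Phase-2 proof seat p15; HOME `run/shared/lean/pub/lit-balaban/`).  SKELETON row **B2.Eq2.42**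
((2.20)–(2.42) «first-step manipulations», D-rows carved display by display; members (2.20)–(2.21) here; (2.28)–(2.29) are this
seat's `…B2Eq228Conditioning`).  Fold owners r02 / r14, referee ref-4.

WHAT IS PRINTED (verbatim, p. 561 [PDF 7]): *"A″ is a small field and we can expand the action with respect to this field. At
first let us notice that the restrictions (2.16) on the scalar fields can be replaced by the same restrictions putting B̃⁽¹⁾
instead of A and c₁p(ε) instead of p(ε), with some constant c₁ independent of ε. Similarly the characteristic functions
χ_{Λ₋₁,s} for the scalar fields can be estimated by the corresponding characteristic functions with B̃⁽¹⁾ and c₁p(ε) instead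
of A and p(ε). For example, we have (D_Aφ)(b) = (D_{B̃⁽¹⁾}φ)(b) + (U(A″_b) − 1)U(B̃_b⁽¹⁾)φ(b₊), (2.20) hence
|(D_{B̃⁽¹⁾}φ)(b)| ≦ |(D_Aφ)(b)| + |U(A″_b) − 1||φ(b₊)| ≦ p(ε) + e(ε)O(1)p(ε)(1/λ(ε)^{1/4})p(ε) ≦ c₁p(ε). (2.21)
The remaining restrictions can be considered in a similar way."*  Context: (2.19) p. 560 `A = B̃⁽¹⁾ + A″`; (1.1)/(2.5)
`λ(ε) = λε^{4−d}`, `e(ε) = eε^{(4−d)/2}`; the restrictions (2.2)/(2.16): `|(D_Aφ)(b)| ≦ p(ε)`, `|φ(x)| ≦ λ(ε)^{−1/4}p(ε)`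
(small field), and p. 560 `|A′(x)| ≦ O(1)p(ε)` giving `|U(A″_b) − 1| ≦ e(ε)O(1)p(ε)`.

THE MODEL.  The covariant derivative is the tree's `LatticeFieldCalculus.covDerivScalar c Urep A φ b = c·(U(A_b)φ(b₊) − φ(b₋))`
([Balaban1982Higgs1] (1.7); `c = ε⁻¹`, here kept general — the printed (2.20) is the display with the prefactor carried by
both covariant derivatives and by the correction term) over an abstract representation `Urep : ℝ → W →ₗ[ℝ] W` with the
REPRESENTATION PROPERTY `U(a + a′) = U(a)U(a′)` as the hypothesis `hadd` (discharged for the printed `U(A) = exp(qηeA)` by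
p32's `ChargeData.Urep_add` in `eq220_Urep`) and, for (2.21), UNITARITY `|U(a)v| = |v|` (`ChargeData.norm_Urep_apply`).

WHAT THIS MODULE PROVES (kernel-checked, 0 `sorry`, standard axioms; THEOREMS ONLY).  `eq220` (the identity, abstract `Urep`),
`eq220_Urep` (the printed representation), `ineq221` (the first inequality of (2.21): triangle inequality + unitarity, with
`|U(A″_b) − 1|` as an operator bound `u`), `ineq221_Urep`, `scale221_le` (the ε-bookkeeping of the middle term:
`e(ε)·p(ε)/λ(ε)^{1/4} = (e/λ^{1/4})·ε^{(4−d)/4}p(ε) ≦ (e/λ^{1/4})·b₀max{1, 4p/(4−d)}ᵖ` on `(0,1]` for `d ≦ 3` — «c₁ independent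
of ε», by this seat's `one_add_log_inv_rpow_mul_rpow_le`) and **`ineq221_printed`** (the whole chain: under the three printed
restrictions, `|(D_{B̃⁽¹⁾}φ)(b)| ≦ c₁p(ε)` with the explicit ε-independent `c₁ = 1 + O(1)·e·b₀max{1,4p/(4−d)}ᵖ/λ^{1/4}`).
HONEST SCOPE.  (i) B̃⁽¹⁾, A″ of (2.19) are arbitrary bond fields here (the identity (2.20) holds for any splitting); (ii) the
bound `|U(A″_b) − 1| ≦ e(ε)O(1)p(ε)` is the displayed hypothesis `hu` (it needs `|A″| ≦ O(1)p(ε)` of p. 560, proved in §3 of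
the paper); (iii) «the remaining restrictions … in a similar way» are not typed.
-/

noncomputable section

open scoped BigOperators

namespace Literature.MathematicalPhysics.QuantumFieldTheory.Balaban1983to89.B2Eq220CovDerivSplit

open LatticeFieldCalculus

/-! ## §1 (2.20) -/

section Identity

variable {P : Params} {j : ℕ} {W : Type*} [NormedAddCommGroup W] [InnerProductSpace ℝ W]

/-- **(2.20)** p. 561: *"(D_Aφ)(b) = (D_{B̃⁽¹⁾}φ)(b) + (U(A″_b) − 1)U(B̃_b⁽¹⁾)φ(b₊)"* for `A = B̃⁽¹⁾ + A″` ((2.19)), over the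
tree's covariant derivative `(D_Aφ)(b) = c·(U(A_b)φ(b₊) − φ(b₋))` and any representation `U` of `(ℝ,+)` (`hadd`; the prefactor
`c` multiplies the correction term as it does both derivatives). [cite: Balaban1982Higgs2, (2.20) p.561] -/
theorem eq220 (c : ℝ) (Urep : ℝ → W →ₗ[ℝ] W) (hadd : ∀ a a' : ℝ, Urep (a + a') = Urep a ∘ₗ Urep a')
    (Bt A2 : VecField P j ℝ) (φ : SiteField P j W) (b : PBond P j) :
    covDerivScalar c Urep (Bt + A2) φ b
      = covDerivScalar c Urep Bt φ b + c • (Urep (A2 b) (Urep (Bt b) (φ b.tgt)) - Urep (Bt b) (φ b.tgt)) := by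
  simp only [covDerivScalar, Pi.add_apply]
  rw [add_comm (Bt b) (A2 b), hadd, LinearMap.comp_apply, ← smul_add]
  congr 1
  abel

/-- (2.20) for the printed representation `U(A) = exp(qηeA)` (`HiggsLattice.ChargeData.Urep`; the representation property is
p32's `ChargeData.Urep_add`). [cite: Balaban1982Higgs2, (2.20) p.561] -/
theorem eq220_Urep {N : ℕ} (C : HiggsLattice.ChargeData N) (η c : ℝ) (Bt A2 : VecField P j ℝ)
    (φ : SiteField P j (EuclideanSpace ℝ (Fin N))) (b : PBond P j) :
    covDerivScalar c (C.Urep η) (Bt + A2) φ b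
      = covDerivScalar c (C.Urep η) Bt φ b + c • (C.Urep η (A2 b) (C.Urep η (Bt b) (φ b.tgt)) - C.Urep η (Bt b) (φ b.tgt)) :=
  eq220 c (C.Urep η) (fun a a' => C.Urep_add η a a') Bt A2 φ b

/-! ## §2 (2.21), first inequality -/

/-- **(2.21), first inequality** p. 561: *"|(D_{B̃⁽¹⁾}φ)(b)| ≦ |(D_Aφ)(b)| + |U(A″_b) − 1||φ(b₊)|"* — from (2.20), the triangle
inequality and unitarity `|U(B̃_b)φ(b₊)| = |φ(b₊)|` (`hiso`); `|U(A″_b) − 1|` enters as an operator bound `u` (`hu`), and the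
prefactor `|c|` of the tree's covariant derivative is displayed. [cite: Balaban1982Higgs2, (2.21) p.561] -/
theorem ineq221 (c : ℝ) (Urep : ℝ → W →ₗ[ℝ] W) (hadd : ∀ a a' : ℝ, Urep (a + a') = Urep a ∘ₗ Urep a')
    (hiso : ∀ (a : ℝ) (v : W), ‖Urep a v‖ = ‖v‖) (Bt A2 : VecField P j ℝ) (φ : SiteField P j W) (b : PBond P j)
    {u : ℝ} (hu : ∀ v : W, ‖Urep (A2 b) v - v‖ ≤ u * ‖v‖) :
    ‖covDerivScalar c Urep Bt φ b‖ ≤ ‖covDerivScalar c Urep (Bt + A2) φ b‖ + |c| * (u * ‖φ b.tgt‖) := by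
  have h := eq220 c Urep hadd Bt A2 φ b
  have h' : covDerivScalar c Urep Bt φ b = covDerivScalar c Urep (Bt + A2) φ b
      - c • (Urep (A2 b) (Urep (Bt b) (φ b.tgt)) - Urep (Bt b) (φ b.tgt)) := by
    rw [h]; abel
  rw [h']
  calc ‖covDerivScalar c Urep (Bt + A2) φ b - c • (Urep (A2 b) (Urep (Bt b) (φ b.tgt)) - Urep (Bt b) (φ b.tgt))‖
      ≤ ‖covDerivScalar c Urep (Bt + A2) φ b‖ + ‖c • (Urep (A2 b) (Urep (Bt b) (φ b.tgt)) - Urep (Bt b) (φ b.tgt))‖ :=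
        norm_sub_le _ _
    _ = ‖covDerivScalar c Urep (Bt + A2) φ b‖ + |c| * ‖Urep (A2 b) (Urep (Bt b) (φ b.tgt)) - Urep (Bt b) (φ b.tgt)‖ := by
        rw [norm_smul, Real.norm_eq_abs]
    _ ≤ ‖covDerivScalar c Urep (Bt + A2) φ b‖ + |c| * (u * ‖φ b.tgt‖) := by
        gcongr
        calc ‖Urep (A2 b) (Urep (Bt b) (φ b.tgt)) - Urep (Bt b) (φ b.tgt)‖ ≤ u * ‖Urep (Bt b) (φ b.tgt)‖ := hu _
          _ = u * ‖φ b.tgt‖ := by rw [hiso]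

/-- (2.21), first inequality, for the printed `U(A) = exp(qηeA)` (unitarity = p32's `ChargeData.norm_Urep_apply`).
[cite: Balaban1982Higgs2, (2.21) p.561] -/
theorem ineq221_Urep {N : ℕ} (C : HiggsLattice.ChargeData N) (η c : ℝ) (Bt A2 : VecField P j ℝ)
    (φ : SiteField P j (EuclideanSpace ℝ (Fin N))) (b : PBond P j) {u : ℝ}
    (hu : ∀ v, ‖C.Urep η (A2 b) v - v‖ ≤ u * ‖v‖) :
    ‖covDerivScalar c (C.Urep η) Bt φ b‖
      ≤ ‖covDerivScalar c (C.Urep η) (Bt + A2) φ b‖ + |c| * (u * ‖φ b.tgt‖) :=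
  ineq221 c (C.Urep η) (fun a a' => C.Urep_add η a a') (fun a v => C.norm_Urep_apply η a v) Bt A2 φ b hu

end Identity

/-! ## §3 (2.21), the constant `c₁` is independent of ε -/

/-- **The ε-bookkeeping of (2.21)**: with `p(ε) = b₀(1 + log ε⁻¹)ᵖ` (`B2.pFn`), `λ(ε) = λε^{4−d}` (`B2LargeField.lambdaEps`,
threshold `thrPhi = p(ε)/λ(ε)^{1/4}`) and `e(ε) = eε^{(4−d)/2}`: for `d ≦ 3` and `0 < ε ≦ 1`,
`e(ε)·(p(ε)/λ(ε)^{1/4}) = (e/λ^{1/4})·ε^{(4−d)/4}p(ε) ≦ (e/λ^{1/4})·b₀·max{1, p/((4−d)/4)}ᵖ` — a logarithm against a positive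
power (this seat's `B2Sect3AGaussianStep.one_add_log_inv_rpow_mul_rpow_le`). [cite: Balaban1982Higgs2, (2.21) p.561] -/
theorem scale221_le {b₀ p e lam : ℝ} (hb : 0 ≤ b₀) (hp : 0 < p) (he : 0 ≤ e) (hlam : 0 < lam) {d : ℕ} (hd : d ≤ 3)
    {ε : ℝ} (hε : 0 < ε) (hε1 : ε ≤ 1) :
    e * ε ^ (((4 : ℝ) - d) / 2) * B2LargeField.thrPhi lam ε d (B2.pFn b₀ p ε)
      ≤ e / lam ^ (1 / 4 : ℝ) * (b₀ * (max 1 (p / (((4 : ℝ) - d) / 4))) ^ p) := by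
  have hd' : (d : ℝ) ≤ 3 := by exact_mod_cast hd
  have hs : (0 : ℝ) < ((4 : ℝ) - d) / 4 := by linarith
  have key := B2Sect3AGaussianStep.one_add_log_inv_rpow_mul_rpow_le hp hs hε hε1
  have hlamq : 0 < lam ^ (1 / 4 : ℝ) := Real.rpow_pos_of_pos hlam _
  have hroot : (B2LargeField.lambdaEps lam ε d) ^ (1 / 4 : ℝ) = lam ^ (1 / 4 : ℝ) * ε ^ (((4 : ℝ) - d) / 4) := by
    rw [B2LargeField.lambdaEps, Real.mul_rpow hlam.le (zpow_nonneg hε.le _), ← Real.rpow_intCast,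
      ← Real.rpow_mul hε.le]
    congr 2
    push_cast
    ring
  have hlog0 : 0 ≤ (1 + Real.log ε⁻¹) ^ p := by
    apply Real.rpow_nonneg
    have := Real.log_nonpos hε.le hε1
    rw [Real.log_inv]; linarith
  -- e ε^{(4−d)/2} · b₀(1+log ε⁻¹)ᵖ/(λ^{1/4}ε^{(4−d)/4}) = (e/λ^{1/4}) b₀ [(1+log ε⁻¹)ᵖ ε^{(4−d)/4}]
  have hεq : 0 < ε ^ (((4 : ℝ) - d) / 4) := Real.rpow_pos_of_pos hε _
  have hsplit : ε ^ (((4 : ℝ) - d) / 2) = ε ^ (((4 : ℝ) - d) / 4) * ε ^ (((4 : ℝ) - d) / 4) := by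
    rw [← Real.rpow_add hε]; ring_nf
  rw [B2LargeField.thrPhi, B2.pFn, hroot, hsplit]
  calc e * (ε ^ (((4 : ℝ) - d) / 4) * ε ^ (((4 : ℝ) - d) / 4))
        * (b₀ * (1 + Real.log ε⁻¹) ^ p / (lam ^ (1 / 4 : ℝ) * ε ^ (((4 : ℝ) - d) / 4)))
      = e / lam ^ (1 / 4 : ℝ) * (b₀ * ((1 + Real.log ε⁻¹) ^ p * ε ^ (((4 : ℝ) - d) / 4))) := by
        field_simp
    _ ≤ e / lam ^ (1 / 4 : ℝ) * (b₀ * (max 1 (p / (((4 : ℝ) - d) / 4))) ^ p) := by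
        gcongr

/-- **(2.21), the whole printed chain** p. 561: under the restrictions `|(D_Aφ)(b)| ≦ p(ε)` ((2.2)/(2.16), `A = B̃⁽¹⁾ + A″`),
`|φ(b₊)| ≦ λ(ε)^{−1/4}p(ε)` and `|U(A″_b) − 1| ≦ e(ε)·O(1)·p(ε)` (from p. 560 `|A″| ≦ O(1)p(ε)`; operator bound, hypothesis
`hu`), the triangle inequality (2.20) ⇒ `|(D_{B̃⁽¹⁾}φ)(b)| ≦ p(ε) + e(ε)O(1)p(ε)·λ(ε)^{−1/4}p(ε) ≦ c₁p(ε)` with the EXPLICIT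
ε-independent `c₁ = 1 + O(1)·e·b₀·max{1, p/((4−d)/4)}ᵖ/λ^{1/4}` (d ≦ 3, 0 < ε ≦ 1; the tree's derivative prefactor taken
`c = 1` as in the display). [cite: Balaban1982Higgs2, (2.20)–(2.21) p.561] -/
theorem ineq221_printed {P : Params} {j : ℕ} {W : Type*} [NormedAddCommGroup W] [InnerProductSpace ℝ W]
    (Urep : ℝ → W →ₗ[ℝ] W) (hadd : ∀ a a' : ℝ, Urep (a + a') = Urep a ∘ₗ Urep a')
    (hiso : ∀ (a : ℝ) (v : W), ‖Urep a v‖ = ‖v‖) (Bt A2 : VecField P j ℝ) (φ : SiteField P j W) (b : PBond P j)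
    {b₀ p e lam O₁ ε : ℝ} (hb : 0 ≤ b₀) (hp : 0 < p) (he : 0 ≤ e) (hlam : 0 < lam) (hO : 0 ≤ O₁) {d : ℕ}
    (hd : d ≤ 3) (hε : 0 < ε) (hε1 : ε ≤ 1)
    (hDA : ‖covDerivScalar 1 Urep (Bt + A2) φ b‖ ≤ B2.pFn b₀ p ε)
    (hφ : ‖φ b.tgt‖ ≤ B2LargeField.thrPhi lam ε d (B2.pFn b₀ p ε))
    (hu : ∀ v : W, ‖Urep (A2 b) v - v‖ ≤ e * ε ^ (((4 : ℝ) - d) / 2) * O₁ * B2.pFn b₀ p ε * ‖v‖) :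
    ‖covDerivScalar 1 Urep Bt φ b‖
      ≤ (1 + O₁ * (e / lam ^ (1 / 4 : ℝ) * (b₀ * (max 1 (p / (((4 : ℝ) - d) / 4))) ^ p))) * B2.pFn b₀ p ε := by
  have h1 := ineq221 1 Urep hadd hiso Bt A2 φ b hu
  rw [abs_one, one_mul] at h1
  have hpε : 0 ≤ B2.pFn b₀ p ε := by
    rw [B2.pFn]
    apply mul_nonneg hb
    apply Real.rpow_nonneg
    have := Real.log_nonpos hε.le hε1
    rw [Real.log_inv]; linarith
  have hcoef : 0 ≤ e * ε ^ (((4 : ℝ) - d) / 2) * O₁ * B2.pFn b₀ p ε := by positivity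
  have h2 := scale221_le hb hp he hlam hd hε hε1
  calc ‖covDerivScalar 1 Urep Bt φ b‖
      ≤ ‖covDerivScalar 1 Urep (Bt + A2) φ b‖ + e * ε ^ (((4 : ℝ) - d) / 2) * O₁ * B2.pFn b₀ p ε * ‖φ b.tgt‖ := h1
    _ ≤ B2.pFn b₀ p ε
        + e * ε ^ (((4 : ℝ) - d) / 2) * O₁ * B2.pFn b₀ p ε * B2LargeField.thrPhi lam ε d (B2.pFn b₀ p ε) := by
        gcongr
    _ = B2.pFn b₀ p ε
        + O₁ * (e * ε ^ (((4 : ℝ) - d) / 2) * B2LargeField.thrPhi lam ε d (B2.pFn b₀ p ε)) * B2.pFn b₀ p ε := by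
        ring
    _ ≤ B2.pFn b₀ p ε + O₁ * (e / lam ^ (1 / 4 : ℝ) * (b₀ * (max 1 (p / (((4 : ℝ) - d) / 4))) ^ p)) * B2.pFn b₀ p ε := by
        gcongr
    _ = (1 + O₁ * (e / lam ^ (1 / 4 : ℝ) * (b₀ * (max 1 (p / (((4 : ℝ) - d) / 4))) ^ p))) * B2.pFn b₀ p ε := by
        ring

end Literature.MathematicalPhysics.QuantumFieldTheory.Balaban1983to89.B2Eq220CovDerivSplit
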